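import Literature.Analysis.FluidPDE.OseenPotentialDeformedBound
import Literature.Analysis.Complex.GraphContourDeformationDirectionLocal
import HarnessLib

/-!
# Flat Oseen potentials at complex points are bounded through deformed contours, localised

Analysis/FluidPDE support file (theorems only), the localised form of
`OseenPotentialDeformedBound.lean` (`exists_norm_integral_oseenKernelC_flat_le`), module (C2c′) of
the proof of the named fact `bradshawGrujicKukavica2015_local_analyticity_radius`
(Bradshaw–Grujić–Kukavica 2015, Thm. 2.3). There the deformation graphs `cx w + iθφ(w)y` had to
lie in the open set of holomorphy `Ω` for **every** `w`, which forces `Ω ⊇ ℝ^{n+1}` — never the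
case for the localised iterates (they are not analytic on the cut-off annulus). Here the graphs
are required to lie in `Ω` only for `w` in an open **convex** `U₀ ⊇ tsupport φ`; at the other real
points the contour is not moved and only the flat integrand (measurable, integrable) is seen:

  `‖∫ K_ℂ(ρ, z - cx w)[A(cx w), B(cx w)] dw‖ ≤ (1 + L) (C M_A M_B / ρ)`
  (`exists_norm_integral_oseenKernelC_flat_le_local`),

by `Literature.Analysis.Complex.integral_graph_deformation_direction_sub_eq_zero` and the sector
bounds of `OseenKernelSectorBounds.lean`, exactly as in the global file.

## References

* Z. Grujić, I. Kukavica, J. Funct. Anal. 152 (1998) 447–466, §2. [GrujicKukavica1998]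
* Z. Bradshaw, Z. Grujić, I. Kukavica, J. Differential Equations 259 (2015), §3, (3.1)–(3.3),
  Lemma 3.2. [BradshawGrujicKukavica2015]
-/

noncomputable section

open MeasureTheory Set Function Filter Metric Real
open _root_.Topology
open _root_.Complex (I)
open scoped ENNReal
open Literature.Analysis.FunctionSpaces.EuclideanSpace (complexify complexify_apply norm_complexify)

namespace Literature.Analysis.FluidPDE

/-- **Flat Oseen potentials at complex points, bounded through a locally deformed contour.**
There is `C = C(ι) > 0` such that: for `ρ > 0`, real `x, y`, an open `Ω ⊆ ℂ^ι`, `A, B`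
holomorphic on `Ω`, a profile `φ ∈ C¹` with compact support contained in an open convex `U₀`,
`|∂_yφ| ≤ L`, whose graphs `cx w + iθφ(w)y`, `0 ≤ θ ≤ 1`, **over `w ∈ U₀`** lie in `Ω`, with the
residual shift admissible everywhere, `‖(φ w - 1)y‖ ≤ ‖x - w‖/2 + ρ`, and `‖A‖ ≤ M_A`,
`‖B‖ ≤ M_B` on the graph `θ = 1` (real points included): if the flat integrand is integrable, then
`‖∫ oseenKernelC ρ (cx x + i cx y - cx w) (A (cx w)) (B (cx w)) dw‖ ≤ (1 + L) C M_A M_B / ρ`.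
[cite: BradshawGrujicKukavica2015, §3 Lemma 3.2 (the mechanism, in contour form)] -/
theorem exists_norm_integral_oseenKernelC_flat_le_local {n : ℕ} :
    ∃ C : ℝ, 0 < C ∧ ∀ {ρ : ℝ}, 0 < ρ → ∀ (x y : EuclideanSpace ℝ (Fin (n + 1)))
      {Ω : Set (EuclideanSpace ℂ (Fin (n + 1)))}, IsOpen Ω →
      ∀ {A B : EuclideanSpace ℂ (Fin (n + 1)) → EuclideanSpace ℂ (Fin (n + 1))},
        DifferentiableOn ℂ A Ω → DifferentiableOn ℂ B Ω →
      ∀ {φ : EuclideanSpace ℝ (Fin (n + 1)) → ℝ}, ContDiff ℝ 1 φ → HasCompactSupport φ →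
      ∀ {U₀ : Set (EuclideanSpace ℝ (Fin (n + 1)))}, IsOpen U₀ → Convex ℝ U₀ → tsupport φ ⊆ U₀ →
      ∀ {L : ℝ}, 0 ≤ L → (∀ w, |fderiv ℝ φ w y| ≤ L) →
      (∀ w ∈ U₀, ∀ θ ∈ Icc (0 : ℝ) 1, complexify w + I • complexify ((θ * φ w) • y) ∈ Ω) →
      (∀ w, ‖(φ w - 1) • y‖ ≤ ‖x - w‖ / 2 + ρ) →
      ∀ {MA MB : ℝ}, 0 ≤ MA → 0 ≤ MB →
        (∀ w, ‖A (complexify w + I • complexify (φ w • y))‖ ≤ MA) →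
        (∀ w, ‖B (complexify w + I • complexify (φ w • y))‖ ≤ MB) →
        Integrable (fun w => oseenKernelC (ρ : ℂ) (complexify x + I • complexify y - complexify w)
          (A (complexify w)) (B (complexify w))) →
        ‖∫ w, oseenKernelC (ρ : ℂ) (complexify x + I • complexify y - complexify w)
            (A (complexify w)) (B (complexify w))‖ ≤ (1 + L) * (C * MA * MB / ρ) := by
  obtain ⟨C, hC, hL1⟩ := exists_lintegral_oseenKernelC_imShift_le (ι := Fin (n + 1))
  obtain ⟨C', hC', hK⟩ := exists_norm_oseenKernelC_imShift_le (ι := Fin (n + 1))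
  classical
  refine ⟨C, hC, fun {ρ} hρ x y {Ω} hΩ {A B} hA hB {φ} hφ hφc {U₀} hU₀ hU₀c hsupp {L} hL0 hL hsweep hadm
    {MA MB} hMA hMB hAb hBb hint => ?_⟩
  -- the holomorphic integrand `Ψ(ζ) = K_ℂ(ρ, z - ζ)[A ζ, B ζ]` on `Ω`
  set z : EuclideanSpace ℂ (Fin (n + 1)) := complexify x + I • complexify y with hz
  set Ψ : EuclideanSpace ℂ (Fin (n + 1)) → EuclideanSpace ℂ (Fin (n + 1)) := fun ζ =>
    oseenKernelC (ρ : ℂ) (z - ζ) (A ζ) (B ζ) with hΨ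
  have hρ0 : (ρ : ℂ) ≠ 0 := by exact_mod_cast hρ.ne'
  have hΨd : DifferentiableOn ℂ Ψ Ω := by
    intro ζ hζ
    have hAζ : DifferentiableAt ℂ A ζ := hA.differentiableAt (hΩ.mem_nhds hζ)
    have hBζ : DifferentiableAt ℂ B ζ := hB.differentiableAt (hΩ.mem_nhds hζ)
    exact ((differentiableAt_const (ρ : ℂ)).oseenKernelC ((differentiableAt_const z).sub
      differentiableAt_id) hAζ hBζ hρ0).differentiableWithinAt
  -- the deformed integrand and its domination by the parabolic majorant
  set ζg : EuclideanSpace ℝ (Fin (n + 1)) → EuclideanSpace ℂ (Fin (n + 1)) := fun w =>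
    complexify w + I • complexify (φ w • y) with hζg
  have hdisp : ∀ w, z - ζg w = complexify (x - w) - I • complexify ((φ w - 1) • y) := fun w =>
    complexify_add_I_smul_sub_graph x y w (φ w)
  have hΨg : ∀ w, ‖Ψ (ζg w)‖ ≤ C' * (25 / 6 * ρ ^ 2 + ‖x - w‖ ^ 2) ^
      (-(((Module.finrank ℝ (EuclideanSpace ℝ (Fin (n + 1))) : ℝ) + 1) / 2)) * MA * MB := by
    intro w
    simp only [hΨ, hdisp w]
    have hw0 : 0 ≤ C' * (25 / 6 * ρ ^ 2 + ‖x - w‖ ^ 2) ^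
        (-(((Module.finrank ℝ (EuclideanSpace ℝ (Fin (n + 1))) : ℝ) + 1) / 2)) :=
      mul_nonneg hC'.le (Real.rpow_nonneg (by positivity) _)
    calc _ ≤ C' * (25 / 6 * ρ ^ 2 + ‖x - w‖ ^ 2) ^
          (-(((Module.finrank ℝ (EuclideanSpace ℝ (Fin (n + 1))) : ℝ) + 1) / 2)) *
          ‖A (ζg w)‖ * ‖B (ζg w)‖ := hK hρ (hadm w) _ _
      _ ≤ _ := mul_le_mul (mul_le_mul_of_nonneg_left (hAb w) hw0) (hBb w) (norm_nonneg _)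
          (mul_nonneg hw0 hMA)
  -- measurability of the deformed integrand: continuous over `U₀`, flat elsewhere
  have hφd : Differentiable ℝ φ := hφ.differentiable (by simp)
  have hζgc : Continuous ζg := by rw [hζg]; fun_prop
  have hζgΩ : ∀ w ∈ U₀, ζg w ∈ Ω := fun w hw => by
    have := hsweep w hw 1 ⟨zero_le_one, le_rfl⟩; rwa [one_mul] at this
  have hζg_out : ∀ w, w ∉ U₀ → ζg w = complexify w := fun w hw => by
    have hφ0 : φ w = 0 := image_eq_zero_of_notMem_tsupport fun h => hw (hsupp h)
    simp [hζg, hφ0]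
  have hΨgcU : ContinuousOn (fun w => Ψ (ζg w)) U₀ := hΨd.continuousOn.comp hζgc.continuousOn hζgΩ
  have hΨg_meas : AEStronglyMeasurable (fun w => Ψ (ζg w)) volume := by
    have h1 : AEStronglyMeasurable (fun w => Ψ (ζg w)) (volume.restrict U₀) :=
      hΨgcU.aestronglyMeasurable hU₀.measurableSet
    have h2 : AEStronglyMeasurable (fun w => Ψ (complexify w)) (volume.restrict U₀ᶜ) :=
      hint.aestronglyMeasurable.mono_measure Measure.restrict_le_self
    have h3 := AEStronglyMeasurable.piecewise hU₀.measurableSet h1 h2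
    refine h3.congr (Eventually.of_forall fun w => ?_)
    show U₀.piecewise (fun w => Ψ (ζg w)) (fun w => Ψ (complexify w)) w = Ψ (ζg w)
    by_cases hw : w ∈ U₀
    · rw [Set.piecewise_eq_of_mem _ _ _ hw]
    · rw [Set.piecewise_eq_of_notMem _ _ _ hw, hζg_out w hw]
  have hJc : Continuous fun w => (1 : ℂ) + I * ((fderiv ℝ φ w y : ℝ) : ℂ) := by
    have : Continuous fun w => fderiv ℝ φ w y :=
      (hφ.continuous_fderiv (by simp)).clm_apply continuous_const
    fun_prop
  -- integrability of the deformed integrand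
  set d : ℝ := (Module.finrank ℝ (EuclideanSpace ℝ (Fin (n + 1))) : ℝ) with hd
  have he : d < 2 * ((d + 1) / 2) := by linarith
  have hτ'0 : 0 < 25 / 6 * ρ ^ 2 := by positivity
  have hmajor : Integrable fun w : EuclideanSpace ℝ (Fin (n + 1)) =>
      (1 + L) * (C' * (25 / 6 * ρ ^ 2 + ‖x - w‖ ^ 2) ^ (-((d + 1) / 2)) * MA * MB) := by
    have h0 := (integrable_add_norm_sq_rpow_neg he hτ'0).comp_sub_left x
    have h1 : Integrable fun w : EuclideanSpace ℝ (Fin (n + 1)) =>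
        ((1 + L) * C' * MA * MB) * (25 / 6 * ρ ^ 2 + ‖x - w‖ ^ 2) ^ (-((d + 1) / 2)) :=
      h0.const_mul _
    refine h1.congr (Eventually.of_forall fun w => ?_)
    simp only; ring
  have hintL : Integrable fun w : EuclideanSpace ℝ (Fin (n + 1)) =>
      ((1 : ℂ) + I * ((fderiv ℝ φ w y : ℝ) : ℂ)) • Ψ (ζg w) := by
    refine hmajor.mono' (hJc.aestronglyMeasurable.smul hΨg_meas) (Eventually.of_forall fun w => ?_)
    rw [norm_smul]
    refine mul_le_mul ((norm_one_add_I_mul_ofReal_le _).trans (by linarith [hL w])) (hΨg w)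
      (norm_nonneg _) (by linarith)
  -- contour deformation (localised): `∫ (deformed - flat) = 0`
  have hdef := Literature.Analysis.Complex.integral_graph_deformation_direction_sub_eq_zero hΩ hΨd y
    hφ hφc hU₀ hU₀c hsupp hsweep (hintL.sub hint)
  rw [integral_sub hintL hint, sub_eq_zero] at hdef
  -- `Ψ (cx w)` is the flat integrand
  rw [show (∫ w, oseenKernelC (ρ : ℂ) (complexify x + I • complexify y - complexify w)
      (A (complexify w)) (B (complexify w))) = ∫ w, Ψ (complexify w) from rfl, ← hdef]
  calc ‖∫ w, ((1 : ℂ) + I * ((fderiv ℝ φ w y : ℝ) : ℂ)) • Ψ (ζg w)‖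
      ≤ ∫ w, ‖((1 : ℂ) + I * ((fderiv ℝ φ w y : ℝ) : ℂ)) • Ψ (ζg w)‖ :=
        norm_integral_le_integral_norm _
    _ ≤ ∫ w, (1 + L) * ‖Ψ (ζg w)‖ := by
        have hi2 : Integrable fun w => (1 + L) * ‖Ψ (ζg w)‖ :=
          hmajor.mono' ((hΨg_meas.norm.const_mul _))
            (Eventually.of_forall fun w => by
              rw [Real.norm_eq_abs, abs_of_nonneg (mul_nonneg (by linarith) (norm_nonneg _))]
              exact mul_le_mul_of_nonneg_left (hΨg w) (by linarith))
        refine integral_mono_of_nonneg (Eventually.of_forall fun w => norm_nonneg _) hi2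
          (Eventually.of_forall fun w => ?_)
        dsimp only
        rw [norm_smul]
        exact mul_le_mul_of_nonneg_right
          ((norm_one_add_I_mul_ofReal_le _).trans (by linarith [hL w])) (norm_nonneg _)
    _ = (1 + L) * ∫ w, ‖Ψ (ζg w)‖ := integral_const_mul _ _
    _ ≤ (1 + L) * (C * MA * MB / ρ) := by
        refine mul_le_mul_of_nonneg_left ?_ (by linarith)
        rw [integral_norm_eq_lintegral_enorm hΨg_meas]
        have hl := hL1 hρ x (η := fun w => (φ w - 1) • y) hadm (A := fun w => A (ζg w))
          (B := fun w => B (ζg w)) hMA hMB hAb hBb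
        have hl' : ∫⁻ w, ‖Ψ (ζg w)‖ₑ ≤ ENNReal.ofReal (C * MA * MB / ρ) := by
          refine le_trans (le_of_eq ?_) hl
          refine lintegral_congr fun w => ?_
          simp only [hΨ, hdisp w]
        exact ENNReal.toReal_le_of_le_ofReal (by positivity) hl'

end Literature.Analysis.FluidPDE

end
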